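/- Copyright: the b2b-balaban cell (near-miss cell 7), T⁴-continuum fan-out; row NE7b OWNER lineage `t4-ne7b-p1`
(gen 99, ruling W-ne7bp1-g99-1) — owner elaboration v1.3 for INTERFACE REQUEST NE7b IR-97-2 ((A2) module 1 of the
(α)-instance), part 3 of 3 = gen 98's part 2 §9 RE-TYPED PER REGION after the refuter's located point π-IR97-2
(PRICING-NE7b v50) and split off for the 400-line lint; typed ∕ filed by the gaps seat pub-balaban-gaps-ne6 (typist under
W-ne7bp1-g98-1 ∕ -2, X-read chair leaf-04).  Released under the licence of the surrounding project. -/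
import Literature.MathematicalPhysics.QuantumFieldTheory.Balaban1983to89.B16Ineq179
import Summits.QuantumFields.BalabanUV.T4Continuum.Support.B16HistoryReprInstance

/-!
# (α)-INSTANCE, milestone (A2) module 1, part 3 of 3: THE (1.79) SLOTS OF IR-97-1 TIED TO THE TOWER's UNIT WEIGHTS, PER
REGION — re-open object (α) of row NE7b (`SCOPE-alpha.md` v2.27 §5; memo `g61/NC-NE7b-alpha-OPTIONS.md` §2 (A2));
INTERFACE REQUEST NE7b IR-97-2 of the row OWNER `t4-ne7b-p1` (part 1 = `B16HistoryReprChain`, part 2 = `B16HistoryReprInstance`)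

Summits-side support leaf of the T⁴-continuum cell (rung (B)+1 on a FINITE torus only; NOT infinite volume, NOT the mass
gap, NOT Clay; NOT a proof of NE7b — the cell's OWN estimate, NOT PRINTED, NOT PROVED).  [folklore] finite-sum algebra over
part 1 (`Tower.opsAlong`, `opsAlong_one_le`, `eterm_eq_opsAlong`), part 2 (`reprOf`, `TZh_true_one`) and the Literature leaf
`B16Ineq179` (`Ineq179`, `Txt383`, `ineq179_of_factors` — the junction); nothing printed is asserted, no `def … : Prop`
fact of Bałaban's, no cite-tagged hypothesis, zero `sorry`.  [Balaban1989LargeFieldII] (1.71) p. 378, (1.79) p. 383 and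
p. 383 l. 21–28 are quoted as LOCATORS only.

WHY ∕ WHAT (refuter π-IR97-1 «UNTIED SLOTS», PRICING-NE7b v49 F280: «make the link between IR-97-1's (1.79) slots and the
tower DEFINITIONAL»; π-IR97-2, v50: gen 98's tie over `Dom := Unit` with `adm := T.adm K ∋ hsmall` is VACUOUS-IN-READING —
`Txt383.admissible_le`, a Kraft-type inequality, forces `adm = {hsmall}` as soon as the all-small history carries no
large-field volume (refuter witness `eq_singleton_of_txt383`, owner-verified), and p. 383's count is PER REGION `X`, not
pooled over the torus).  (1.79) p. 383 *"holds for all large field regions"*: `∀ X` over a region type `Dom`, the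
admissible sequences OF THE REGION `adm X` ((1.71) p. 378), the pure small-field term being no `𝐓′_k(X)`.  So, for the
tower at cutoff `K` and ANY region-indexed family `adm : Dom → Finset (Fin K → P)` of histories — the consumer's (A3) datum
(R-OWNER-63-1, journal l.42013: «`adm X` := the `HZs` history coordinate» LOCALISED at `X`, the all-small history NOT a
member), NOT made here —: **`unitOf V h`** := `(opsAlong K h) 1 V`, one history's unit weight; **`T1Of adm X V`** :=
`Σ_{h ∈ adm X} unitOf V h` = the (1.79) subject `𝐓′_K(X)1` of IR-97-1's `StepCarriers.T1`, a PARTIAL SUM of the tower's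
unit weights (`T1Of_le_of_subset`); `B16Ineq179.ineq179_of_factors`'s (1.71)-input `hsum` is then an EQUALITY
(`T1Of_eq_sum`), `hterm` is positivity (`unitOf_nonneg`), and its penultimate per-sequence form `hfac` REDUCES, by part 1's
`opsAlong_one_le`, to ONE displayed identification `hw179` of the product of per-step envelopes `wAlong w K h` with
(1.79)'s double product read off the history — (A1c)∕(A3)'s reading of `d′_j(Z_j)`, the components and the primed
components off the choices, NOT made here —, whence **`ineq179_of_unnested`**: `Ineq179 adm (T1Of T K adm) K …` with the
first exponential's constant `cV + cA + cE`.  And part 2's history operation `(reprOf …).TZh true h` applied to `1` (the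
normalised history term) is at most the SAME unit weight (**`TZh_true_one_le_unit`**, B-free).

NOT HERE (honest).  The regions, the localisation, the readings `dZ`∕`comps`∕`primed`∕`gInt`∕`aInt`∕`volZ` off a history,
and whether Bałaban's admissible families satisfy `Txt383` ∕ `hw179` — (A1c)∕(A3).  BY-NAME EFFECT ON THE WALL
(`WALL-NE7b-P1.md` §2): NONE.  HONEST DEPENDENCY (cell): continuum YM on T⁴ ⇐ BetaPertH ∧ nine spine estimates (0/9
proved); BetaPertH ⇐ (D1) ∧ (D4) ∧ CAP+tail; G-an2-4 gates asym, D1 and NE2/3/4.  This file changes none of it.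
-/

open Finset
open Literature.MathematicalPhysics.QuantumFieldTheory.Balaban1983to89

namespace Summit.QuantumFields.BalabanUV.T4Continuum.B16HistoryReprTie179

open Summit.QuantumFields.BalabanUV.T4Continuum.B16HistoryIndexedRepr
open Summit.QuantumFields.BalabanUV.T4Continuum.B16HistoryReprChain
open Summit.QuantumFields.BalabanUV.T4Continuum.B16HistoryReprInstance

/-! ## §9 The (1.79) slots of IR-97-1 tied to the tower's unit weights, per region -/

section Tie179

open Literature.MathematicalPhysics.QuantumFieldTheory.Balaban1983to89.B16Ineq179

variable {P : Type} {C : ℕ → Type} {𝒢 : (j : ℕ) → GoodClass (C j)} (T : Tower P C 𝒢) (K : ℕ)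

/-- **THE UNIT WEIGHT OF ONE HISTORY** `(opsAlong K h) 1` at the level-`K` configuration `V` — the per-sequence term of
(1.71)'s `𝐓′_K(X)1`. [folklore] -/
def unitOf : C K → (Fin K → P) → ℝ := fun V h => (T.opsAlong K h).T (fun _ => 1) V

/-- The per-sequence terms are non-negative (positivity of every step map on the class). [folklore] -/
theorem unitOf_nonneg (V : C K) (h : Fin K → P) : 0 ≤ unitOf T K V h := (T.opsAlong K h).one_nonneg V

variable {Dom : Type} (adm : Dom → Finset (Fin K → P))

/-- **`𝐓′_K(X)1` OF THE REGION `X`** (the (1.79) subject `T1` of IR-97-1's `StepCarriers`): the total unit weight of the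
histories `adm X` localised at `X`, as a function of the level-`K` configuration. [folklore] -/
def T1Of : Dom → C K → ℝ := fun X V => ∑ h ∈ adm X, unitOf T K V h

/-- (1.71)-input of `ineq179_of_factors` as an EQUALITY: `T1Of X = Σ_{h ∈ adm X} unitOf h`. [folklore] -/
theorem T1Of_eq_sum (X : Dom) (V : C K) : T1Of T K adm X V = ∑ h ∈ adm X, unitOf T K V h := rfl

/-- THE TIE TO THE TOWER: a region's `𝐓′_K(X)1` is a PARTIAL SUM of the unit weights of any larger family of histories
`s ⊇ adm X` — e.g. `s := (T.adm K).erase hsmall`, the large summand's `HZs` coordinate of §5. [folklore] -/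
theorem T1Of_le_of_subset {s : Finset (Fin K → P)} (hsub : ∀ X, adm X ⊆ s) (X : Dom) (V : C K) :
    T1Of T K adm X V ≤ ∑ h ∈ s, unitOf T K V h :=
  Finset.sum_le_sum_of_subset_of_nonneg (hsub X) fun h _ _ => unitOf_nonneg T K V h

/-- **(1.79) FOR THE REGIONS' `𝐓′_K(X)1`, FROM THE PER-STEP ENVELOPES + ONE DISPLAYED IDENTIFICATION**: with every
region's family non-empty (`hadm`), the p. 383 integration ∕ count sentences `Txt383` on the region-indexed history data,
per-step unit-weight envelopes `w` (`hw0`, `hw`), and the identification `hw179` of `wAlong w K h` with (1.79)'s double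
product READ OFF the history (the (A1c)∕(A3) reading — displayed), `B16Ineq179.ineq179_of_factors` yields
`Ineq179 adm (T1Of T K adm) K …` with the first exponential's constant `cV + cA + cE`. [folklore] -/
theorem ineq179_of_unnested {ι : Type} (hadm : ∀ X, (adm X).Nonempty)
    {dZ : (Fin K → P) → ℕ → ℝ} {comps primed : (Fin K → P) → ℕ → Finset ι} {dC : (Fin K → P) → ℕ → ι → ℝ}
    {cV cA cE M γ₀ A₁ C' C'' : ℝ} {d : ℕ} {R p0 : ℕ → ℝ} {gInt aInt volZΩ volZ : (Fin K → P) → ℕ → ℝ}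
    (hT : Txt383 adm gInt aInt volZΩ volZ K C' C'' M d R)
    (hg : ∀ X, ∀ h ∈ adm X, ∀ j ∈ Finset.Icc 1 K, 0 ≤ gInt h j)
    (ha : ∀ X, ∀ h ∈ adm X, ∀ j ∈ Finset.Icc 1 K, 0 ≤ aInt h j)
    (w : (j : ℕ) → (Fin j → P) → P → ℝ) (hw0 : ∀ j g p, 0 ≤ w j g p)
    (hw : ∀ j g p x, (T.op j g p).T (fun _ => 1) x ≤ w j g p)
    (hw179 : ∀ X, ∀ h ∈ adm X, Tower.wAlong w K h ≤
      (∏ j ∈ Finset.Icc 1 K, gInt h j * aInt h j * Real.exp (cV * M ^ d * R j ^ (d + 1) * dZ h j)) *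
        ∏ j ∈ Finset.Icc 1 K,
          ((∏ i ∈ comps h j, Real.exp (-(1 / 2) * γ₀ * A₁ ^ 2 * p0 j ^ 2 * (dC h j i + 1) - 2 * p0 j)) *
            ∏ _i ∈ primed h j, Real.exp (-(p0 j))))
    (habsA : ∀ X, ∀ h ∈ adm X, ∀ j ∈ Finset.Icc 1 K, C' * volZΩ h j ≤ cA * M ^ d * R j ^ (d + 1) * dZ h j)
    (habsE : ∀ X, ∀ h ∈ adm X, ∀ j ∈ Finset.Icc 1 K,
      C'' * ((M * R j) ^ d)⁻¹ * volZ h j ≤ cE * M ^ d * R j ^ (d + 1) * dZ h j) :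
    Ineq179 adm (T1Of T K adm) K dZ comps primed dC (cV + cA + cE) M γ₀ A₁ d R p0 :=
  ineq179_of_factors (term := fun _ V h => unitOf T K V h) hadm hT (fun X V => (T1Of_eq_sum T K adm X V).le)
    (fun _ V h _ => unitOf_nonneg T K V h) hg ha
    (fun X V h hh => (T.opsAlong_one_le w hw0 hw K h V).trans (hw179 X h hh)) habsA habsE

variable (p₀ : ℕ → P) [DecidableEq P] {ρ₀ : C 0 → ℝ} (hρ : (𝒢 0).Gd ρ₀) (h0 : ∀ x, 0 ≤ ρ₀ x) {B : ℝ} (hB : 0 < B)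

/-- **M1's HISTORY OPERATION TIED TO THE SAME UNIT WEIGHT, B-FREE**: `|ρ₀| ≤ B` ⟹ `(reprOf …).TZh true h` applied to
`1` (= the normalised history term) is at most the history's unit weight `unitOf h` — (1.72)'s operation and (1.79)'s
subject of the SAME history are linked by a kernel inequality, not by a further hypothesis shape. [folklore] -/
theorem TZh_true_one_le_unit (hBρ : ∀ y, |ρ₀ y| ≤ B) (h : Fin K → P) (W : C K) :
    ((reprOf T p₀ K hρ h0 hB).TZh true h).T (fun _ => 1) W ≤ unitOf T K W h := by
  rw [TZh_true_one]
  refine (inv_mul_le_iff₀ hB).mpr ?_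
  rw [T.eterm_eq_opsAlong]
  exact (le_abs_self _).trans ((T.opsAlong K h).abs_apply_le hρ hBρ W)

end Tie179

end Summit.QuantumFields.BalabanUV.T4Continuum.B16HistoryReprTie179
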